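import Mathlib.Algebra.CharP.Lemmas
import Mathlib.Algebra.Ring.Hom.Defs
import Mathlib.Tactic.LinearCombination
import Mathlib.Tactic.Ring
import HarnessLib

/-!
# Crux `Steer` (stmt-ResolutionOfSingularities-16345), chain W4.1 — hK4′ β-leaf, K-β1♭ Brick I, Case p ≥ 1: THE SOLVABILITY IDENTITY (char 2)

OURS (campaign `res-hironaka`, rung L ★L-G4, slot W4.1; seat res-L0-w41-stub-1 g4 = K-β1♭ owner; blueprint
`L/res-L0-w41-stub-1/KBETA1-BLUEPRINT.md` 4807652a0eeb53d4 §2 «Case p ≥ 1», audited PASS by res-L0-w41-tri-2 g7 `beta18/audit_150a_kbeta1.md`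
3b2fa71c4617380f §2.2). The ring identity behind «a move of v-weight ≥ 1 that raises β exhibits the left vertex as SOLVABLE», abstracted from the
graded ring `gr` to ANY commutative ring of characteristic 2 with: `τ` = the translation `Z ↦ Z + λM, W ↦ W + μM` (an automorphism, inverse `τ'`),
`ε` = «set `M = 0`» (so `ε ∘ τ' = ε`), `T = In_v(f′)` with `ε T = Ψ` (the cone is the `M`-free part), `τ T = Ψ_g + Q²` with `Ψ_g` `M`-free
(`ε Ψ_g = Ψ_g`). CONCLUSION: `T = τ' Ψ + (square)`, i.e. `In_v(f′) = Ψ(Z − λM, W − μM) + Q″²` — `v` is solvable in the combined gauge. They replace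
the role of no printed item and are NOT statements of the manuscript under review [claim: Hironaka2017, status: under-review]; AI review weaker than
expert review. Definition-free; Mathlib only. [cite: CossartPiltant2019, Def. 2.3] [folklore]
-/

-- `Summit.<S>.<S>.…` duplicates the summit name by design (single-problem summit).
set_option linter.dupNamespace false
set_option autoImplicit false

namespace Summit.ResolutionOfSingularities.ResolutionOfSingularities.Theorems.SwitchingDichotomy.BetaPolygon

/-- **The solvability identity** (Brick I, Case p ≥ 1). `τ'` a two-sided inverse of the ring endomorphism `τ`, `ε` an endomorphism with
`ε ∘ τ' = ε`; if `ε T = Ψ`, `τ T = Ψg + Q²` and `ε Ψg = Ψg`, then `T = τ' Ψ + (τ' (ε (τ' Q)) + τ' Q)²`. [cite: CossartPiltant2019, Def. 2.3] -/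
theorem eq_translate_add_sq_of_translate_eq {A : Type} [CommRing A] [CharP A 2] (τ τ' ε : A →+* A)
    (hτ'τ : ∀ a, τ' (τ a) = a) (hετ' : ∀ a, ε (τ' a) = ε a) {T Ψ Ψg Q : A}
    (h1 : ε T = Ψ) (h2 : τ T = Ψg + Q ^ 2) (h3 : ε Ψg = Ψg) :
    T = τ' Ψ + (τ' (ε (τ' Q)) + τ' Q) ^ 2 := by
  -- `T = τ'(Ψg) + (τ' Q)²`
  have hT : T = τ' Ψg + τ' Q ^ 2 := by
    rw [← hτ'τ T, h2, map_add, map_pow]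
  -- `Ψ = ε T = Ψg + (ε τ' Q)²`, so `Ψg = Ψ − (ε τ' Q)²`
  have hΨg : Ψg = Ψ - ε (τ' Q) ^ 2 := by
    have := h1
    rw [hT, map_add, map_pow, hετ', h3] at this
    rw [← this]; ring
  have htwo : (2 : A) = 0 := by simpa using CharP.cast_eq_zero A 2
  rw [hT, hΨg, map_sub, map_pow, add_pow_char]
  linear_combination (-(τ' (ε (τ' Q))) ^ 2) * htwo

end Summit.ResolutionOfSingularities.ResolutionOfSingularities.Theorems.SwitchingDichotomy.BetaPolygon
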